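import Mathlib
import Summits.Ventures.DiscreteObjects.Mahler.OddNonreciprocalBound
import Summits.Ventures.DiscreteObjects.Mahler.SchinzelTotallyReal

/-!
# `M(x² - x - 1) = φ`: sharpness of the odd-nonreciprocal and Schinzel bounds (venture `DiscreteObjects`, target L)

Cell `pub-namedobj`, seat `pub-namedobj-mahler` (gen 8). Framing: lottery ticket; floor = certified
bounds/negative ranges.

* `intMahlerMeasure_X_sq_sub_X_sub_one` — `M(x² - x - 1) = φ = (1+√5)/2` (roots `φ`, `ψ = -1/φ`);
* `isLeast_goldenRatio_odd_nonreciprocal` — the Borwein–Hare–Mossinghoff 2004 bound "odd coefficients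
  and nonreciprocal ⇒ `M ≥ φ`" ([McKee–Smyth Prop. 11.3, second part]; kernel:
  `OddNonreciprocalBound.intMahlerMeasure_ge_goldenRatio_of_odd_nonreciprocal`) is ATTAINED: `φ` is the least
  Mahler measure of a nonreciprocal integer polynomial with all coefficients odd;
* `schinzel_totally_real_sharp` — Schinzel's totally real bound `M(P)² ≥ φ^{deg P}`
  (`SchinzelTotallyReal`) is an equality for `x² - x - 1`.
-/

namespace Summit.Ventures.DiscreteObjects.Mahler

open Polynomial Real

/-- `x² - x - 1 = (x - φ)(x - ψ)` over `ℂ`. -/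
theorem X_sq_sub_X_sub_one_eq :
    (X ^ 2 - X - 1 : ℂ[X]) = (X - C (goldenRatio : ℂ)) * (X - C (goldenConj : ℂ)) := by
  have h1 : (goldenRatio : ℂ) + (goldenConj : ℂ) = 1 := by exact_mod_cast goldenRatio_add_goldenConj
  have h2 : (goldenRatio : ℂ) * (goldenConj : ℂ) = -1 := by exact_mod_cast goldenRatio_mul_goldenConj
  have e : (X - C (goldenRatio : ℂ)) * (X - C (goldenConj : ℂ)) =
      X ^ 2 - C ((goldenRatio : ℂ) + goldenConj) * X + C ((goldenRatio : ℂ) * goldenConj) := by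
    rw [map_add, map_mul]; ring
  rw [e, h1, h2, map_one, map_neg, map_one]; ring

/-- **`M(x² - x - 1) = φ`.** -/
theorem intMahlerMeasure_X_sq_sub_X_sub_one : intMahlerMeasure (X ^ 2 - X - 1 : ℤ[X]) = goldenRatio := by
  unfold intMahlerMeasure
  have hmap : (X ^ 2 - X - 1 : ℤ[X]).map (Int.castRingHom ℂ) = (X ^ 2 - X - 1 : ℂ[X]) := by
    simp [Polynomial.map_sub, Polynomial.map_pow]
  rw [hmap, X_sq_sub_X_sub_one_eq, mahlerMeasure_mul, mahlerMeasure_X_sub_C, mahlerMeasure_X_sub_C,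
    Complex.norm_real, Complex.norm_real, Real.norm_eq_abs, Real.norm_eq_abs,
    abs_of_pos goldenRatio_pos, max_eq_right one_lt_goldenRatio.le,
    max_eq_left (abs_le.mpr ⟨neg_one_lt_goldenConj.le, (goldenConj_neg.trans one_pos).le⟩), mul_one]

/-- `x² - x - 1` has all coefficients odd. -/
theorem X_sq_sub_X_sub_one_odd : ∀ i ≤ (X ^ 2 - X - 1 : ℤ[X]).natDegree, Odd ((X ^ 2 - X - 1 : ℤ[X]).coeff i) := by
  have hdeg : (X ^ 2 - X - 1 : ℤ[X]).natDegree = 2 := by compute_degree!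
  rw [hdeg]
  intro i hi
  interval_cases i <;> simp [coeff_X, coeff_one, coeff_X_pow]

/-- `x² - x - 1` is neither reciprocal nor antireciprocal. -/
theorem X_sq_sub_X_sub_one_nonreciprocal :
    (X ^ 2 - X - 1 : ℤ[X]).reverse ≠ (X ^ 2 - X - 1) ∧ (X ^ 2 - X - 1 : ℤ[X]).reverse ≠ -(X ^ 2 - X - 1) := by
  have hdeg : (X ^ 2 - X - 1 : ℤ[X]).natDegree = 2 := by compute_degree!
  have hc0 : (X ^ 2 - X - 1 : ℤ[X]).reverse.coeff 0 = 1 := by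
    rw [coeff_zero_reverse, ← coeff_natDegree, hdeg]
    simp [coeff_X, coeff_one]
  have hp0 : (X ^ 2 - X - 1 : ℤ[X]).coeff 0 = -1 := by simp [coeff_X, coeff_one]
  have hc1 : (X ^ 2 - X - 1 : ℤ[X]).reverse.coeff 1 = -1 := by
    rw [coeff_reverse, hdeg, revAt_le (by norm_num)]
    simp [coeff_X, coeff_one]
  have hp1 : (X ^ 2 - X - 1 : ℤ[X]).coeff 1 = -1 := by simp [coeff_X, coeff_one]
  constructor
  · intro h
    have h' : (X ^ 2 - X - 1 : ℤ[X]).reverse.coeff 0 = (X ^ 2 - X - 1 : ℤ[X]).coeff 0 := by rw [h]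
    rw [hc0, hp0] at h'
    norm_num at h'
  · intro h
    have h' : (X ^ 2 - X - 1 : ℤ[X]).reverse.coeff 1 = (-(X ^ 2 - X - 1 : ℤ[X])).coeff 1 := by rw [h]
    rw [coeff_neg, hc1, hp1] at h'
    norm_num at h'

/-- **The Borwein–Hare–Mossinghoff bound is attained** [McKee–Smyth Prop. 11.3]: `φ = (1+√5)/2` is the least
Mahler measure of a nonreciprocal integer polynomial with all coefficients odd (witness `x² - x - 1`). -/
theorem isLeast_goldenRatio_odd_nonreciprocal :
    IsLeast {m : ℝ | ∃ P : ℤ[X], (∀ i ≤ P.natDegree, Odd (P.coeff i)) ∧ P.reverse ≠ P ∧ P.reverse ≠ -P ∧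
      intMahlerMeasure P = m} goldenRatio := by
  refine ⟨⟨X ^ 2 - X - 1, X_sq_sub_X_sub_one_odd, X_sq_sub_X_sub_one_nonreciprocal.1,
    X_sq_sub_X_sub_one_nonreciprocal.2, intMahlerMeasure_X_sq_sub_X_sub_one⟩, ?_⟩
  rintro m ⟨P, hodd, h1, h2, rfl⟩
  have h := intMahlerMeasure_ge_goldenRatio_of_odd_nonreciprocal hodd h1 h2
  rw [goldenRatio]
  exact h

/-- **Schinzel's totally real bound is sharp**: for `P = x² - x - 1` (roots `φ, ψ` real, `P(0)P(±1) ≠ 0`),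
`M(P)² = φ² = φ^{deg P}`. -/
theorem schinzel_totally_real_sharp :
    intMahlerMeasure (X ^ 2 - X - 1 : ℤ[X]) ^ 2 = goldenRatio ^ (X ^ 2 - X - 1 : ℤ[X]).natDegree := by
  rw [intMahlerMeasure_X_sq_sub_X_sub_one, show (X ^ 2 - X - 1 : ℤ[X]).natDegree = 2 by compute_degree!]

end Summit.Ventures.DiscreteObjects.Mahler
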